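import Mathlib
import Literature.Geometry.Lorentzian.KerrEnergyIdentity
import Literature.Geometry.Lorentzian.KerrStarWaveOperator
import Literature.Analysis.Calculus.AngularMomentumFields
import Literature.Analysis.Calculus.SphereSpectralShell
import Literature.Analysis.Calculus.SpherePolynomialEigenbasis
import HarnessLib

/-!
# Route EternalPapapetrou · SchwarzschildExteriorModeRigidity — sphere calculus

Helper file for item stmt-FinalStateConjecture-10039 (`SchwarzschildExteriorModeRigidity`).

* slice calculus: derivatives of `y ↦ Φ(t, y)` through those of `Φ`;
* the split `∑ₖ D²q(bₖ, bₖ) = D²q(θ, θ) + (2/r) Dq(θ) + r⁻² T q (rθ)` of the flat Laplacian into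
  its radial part and the spherical Laplacian `T` (`sum_sum_fderiv_fderiv_angularField`);
* integration by parts on spheres against an eigenfunction `G` of `T` of the space of
  homogeneous polynomials of degree `K` (`sphDirichlet_eq_neg_sphereIntegral`), for functions that
  are `C²` only on a shell `{‖y‖ > ρ₀}` (smooth cutoff): `∫ G(θ) (T q)(rθ) = −λ ∫ G(θ) q(rθ)`.
[folklore]
-/

set_option linter.dupNamespace false

noncomputable section

namespace Summit.FinalStateConjecture.FinalStateConjecture.Theorems

open MeasureTheory Set Filter Topology Metric Literature.Geometry.Lorentzian
  Literature.Analysis.Calculus Literature.Analysis.FluidPDE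

namespace EternalPapapetrou.ModeRigidity

/-! ### Slice calculus -/

/-- `y ↦ (t, y)` has derivative `spaceEmbed`. [folklore] -/
theorem hasFDerivAt_ofTimeSpace (t : ℝ) (y : E3) :
    HasFDerivAt (fun y : E3 ↦ E4.ofTimeSpace t y) E4.spaceEmbed y := by
  have : (fun y : E3 ↦ E4.ofTimeSpace t y) = fun y ↦ t • E4.basisVector 0 + E4.spaceEmbed y :=
    funext fun y ↦ E4.ofTimeSpace_eq_smul_add' t y
  rw [this]
  exact (E4.spaceEmbed.hasFDerivAt).const_add _

/-- First derivative of a time slice: `D(Φ(t, ·))(y) = DΦ(t, y) ∘ spaceEmbed`. [folklore] -/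
theorem fderiv_slice {Φ : E4 → ℝ} {t : ℝ} {y : E3}
    (hΦ : DifferentiableAt ℝ Φ (E4.ofTimeSpace t y)) :
    fderiv ℝ (fun y : E3 ↦ Φ (E4.ofTimeSpace t y)) y =
      (fderiv ℝ Φ (E4.ofTimeSpace t y)).comp E4.spaceEmbed :=
  (hΦ.hasFDerivAt.comp y (hasFDerivAt_ofTimeSpace t y)).fderiv

/-- Second derivative of a time slice of a function `C²` on an open set:
`D²(Φ(t, ·))(y)(v, w) = D²Φ(t, y)((0, v), (0, w))`, and `D(Φ(t, ·))` is differentiable at `y`.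
[folklore] -/
theorem fderiv_fderiv_slice {Φ : E4 → ℝ} {O : Set E4} (hO : IsOpen O) (hΦ : ContDiffOn ℝ 2 Φ O)
    {t : ℝ} {y : E3} (hy : E4.ofTimeSpace t y ∈ O) :
    DifferentiableAt ℝ (fderiv ℝ fun y : E3 ↦ Φ (E4.ofTimeSpace t y)) y ∧
      ∀ v w : E3, fderiv ℝ (fderiv ℝ fun y : E3 ↦ Φ (E4.ofTimeSpace t y)) y v w =
        fderiv ℝ (fderiv ℝ Φ) (E4.ofTimeSpace t y) (E4.spaceEmbed v) (E4.spaceEmbed w) := by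
  have hpre : IsOpen ((fun y : E3 ↦ E4.ofTimeSpace t y) ⁻¹' O) :=
    hO.preimage (E4.continuous_ofTimeSpace t)
  -- near `y` the first derivative is `(DΦ ∘ A) ∘ spaceEmbed`
  have hev : fderiv ℝ (fun y : E3 ↦ Φ (E4.ofTimeSpace t y)) =ᶠ[𝓝 y]
      fun z ↦ (fderiv ℝ Φ (E4.ofTimeSpace t z)).comp E4.spaceEmbed := by
    filter_upwards [hpre.mem_nhds hy] with z hz
    exact fderiv_slice ((hΦ.differentiableOn (by norm_num)).differentiableAt (hO.mem_nhds hz))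
  have h1 : ContDiffOn ℝ 1 (fderiv ℝ Φ) O := hΦ.fderiv_of_isOpen hO le_rfl
  have hd : HasFDerivAt (fderiv ℝ Φ) (fderiv ℝ (fderiv ℝ Φ) (E4.ofTimeSpace t y))
      (E4.ofTimeSpace t y) :=
    ((h1.differentiableOn one_ne_zero).differentiableAt (hO.mem_nhds hy)).hasFDerivAt
  have h2 := ((ContinuousLinearMap.compL ℝ E3 E4 ℝ).flip E4.spaceEmbed).hasFDerivAt.comp y
    (hd.comp y (hasFDerivAt_ofTimeSpace t y))
  have h3 : ((ContinuousLinearMap.compL ℝ E3 E4 ℝ).flip E4.spaceEmbed) ∘ fderiv ℝ Φ ∘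
      (fun y : E3 ↦ E4.ofTimeSpace t y) =
      fun z ↦ (fderiv ℝ Φ (E4.ofTimeSpace t z)).comp E4.spaceEmbed := by
    funext z
    simp
  rw [h3] at h2
  have h4 := h2.congr_of_eventuallyEq hev
  refine ⟨h4.differentiableAt, fun v w ↦ ?_⟩
  rw [h4.fderiv]
  simp

/-! ### The spherical Laplacian and the flat Laplacian -/

/-- `T q (y) = ‖y‖² ∑ₖ D²q(y)(bₖ, bₖ) − D²q(y)(y, y) − 2 Dq(y)(y)` on `E3`. [folklore] -/
theorem sphLaplacian_eq {q : E3 → ℝ} {y : E3} (hq : DifferentiableAt ℝ (fderiv ℝ q) y) :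
    sphLaplacian (EuclideanSpace.basisFun (Fin 3) ℝ) q y =
      ‖y‖ ^ 2 * ∑ k, fderiv ℝ (fderiv ℝ q) y (EuclideanSpace.basisFun (Fin 3) ℝ k)
          (EuclideanSpace.basisFun (Fin 3) ℝ k) -
        fderiv ℝ (fderiv ℝ q) y y y - 2 * fderiv ℝ q y y := by
  classical
  unfold sphLaplacian angDeriv
  have h := sum_sum_fderiv_fderiv_angularField (EuclideanSpace.basisFun (Fin 3) ℝ) hq
  simp only [Fintype.card_fin, Nat.cast_ofNat] at h
  have h' : ∑ i, ∑ j, fderiv ℝ (fun x ↦ fderiv ℝ q x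
      (angularField (EuclideanSpace.basisFun (Fin 3) ℝ) i j x)) y
      (angularField (EuclideanSpace.basisFun (Fin 3) ℝ) i j y) =
      ∑ i, ∑ j, fderiv ℝ (fun y ↦ fderiv ℝ q y
        (angularField (EuclideanSpace.basisFun (Fin 3) ℝ) i j y)) y
        (angularField (EuclideanSpace.basisFun (Fin 3) ℝ) i j y) := rfl
  rw [h]
  ring

/-- `spaceEmbed bₖ = ∂_{k+1}`. [folklore] -/
theorem spaceEmbed_basisFun (k : Fin 3) :
    E4.spaceEmbed (EuclideanSpace.basisFun (Fin 3) ℝ k) = E4.basisVector k.succ := by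
  rw [EuclideanSpace.basisFun_apply]
  exact Kerr.spaceEmbed_e k

/-- **The spatial trace through the slice**: for `Φ` of class `C²` on an open set containing
`(t, rθ)`, `‖θ‖ = 1`, `r ≠ 0`,
`∑ᵢ D²Φ(∂ᵢ, ∂ᵢ) = D²Φ(ι, ι) + (2/r) DΦ(ι) + r⁻² T(Φ(t, ·))(rθ)`, `ι = (0, θ)`. [folklore] -/
theorem spatial_trace_eq {Φ : E4 → ℝ} {O : Set E4} (hO : IsOpen O) (hΦ : ContDiffOn ℝ 2 Φ O)
    {t r : ℝ} (hr : r ≠ 0) {θ : E3} (hθ : ‖θ‖ = 1) (hy : E4.ofTimeSpace t (r • θ) ∈ O) :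
    ∑ i : Fin 3, fderiv ℝ (fderiv ℝ Φ) (E4.ofTimeSpace t (r • θ)) (E4.basisVector i.succ)
        (E4.basisVector i.succ) =
      fderiv ℝ (fderiv ℝ Φ) (E4.ofTimeSpace t (r • θ)) (E4.spaceEmbed θ) (E4.spaceEmbed θ) +
        2 / r * fderiv ℝ Φ (E4.ofTimeSpace t (r • θ)) (E4.spaceEmbed θ) +
        (r ^ 2)⁻¹ * sphLaplacian (EuclideanSpace.basisFun (Fin 3) ℝ)
          (fun y : E3 ↦ Φ (E4.ofTimeSpace t y)) (r • θ) := by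
  obtain ⟨hdq, hq2⟩ := fderiv_fderiv_slice hO hΦ hy
  have hq1 : ∀ v, fderiv ℝ (fun y : E3 ↦ Φ (E4.ofTimeSpace t y)) (r • θ) v =
      fderiv ℝ Φ (E4.ofTimeSpace t (r • θ)) (E4.spaceEmbed v) := fun v ↦ by
    rw [fderiv_slice ((hΦ.differentiableOn (by norm_num)).differentiableAt (hO.mem_nhds hy))]
    rfl
  rw [sphLaplacian_eq hdq]
  simp only [hq2, hq1, spaceEmbed_basisFun, map_smul, FunLike.coe_smul,
    Pi.smul_apply, smul_eq_mul, norm_smul, Real.norm_eq_abs, hθ, mul_one, sq_abs]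
  field_simp
  ring

/-! ### Integration by parts on spheres against eigenfunctions -/

/-- `2 ≤ 3`. -/
theorem two_le_three : 2 ≤ 3 := by norm_num

/-- Homogeneity of the eigenfunctions: `G(r θ) = r^K G(θ)`. [folklore] -/
theorem eigenfun_smul {K : ℕ} (a : Fin (MvPoly.HomL2.dim 3 K)) (r : ℝ) (θ : E3) :
    MvPoly.HomL2.eigenfun (K := K) two_le_three a (r • θ) =
      r ^ K * MvPoly.HomL2.eigenfun (K := K) two_le_three a θ := by
  unfold MvPoly.HomL2.eigenfun
  exact MvPoly.toFun_smul_of_isHomogeneous (MvPoly.HomL2.isHomogeneous_val _) r θ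

/-- A smooth radial cutoff: `χ = 0` on `‖y‖ ≤ a`, `χ = 1` on `b ≤ ‖y‖` (`0 < a < b`).
[folklore] -/
theorem exists_radial_cutoff {a b : ℝ} (ha : 0 < a) (hab : a < b) :
    ∃ χ : E3 → ℝ, ContDiff ℝ 2 χ ∧ (∀ y, ‖y‖ ≤ a → χ y = 0) ∧ (∀ y, b ≤ ‖y‖ → χ y = 1) := by
  refine ⟨fun y ↦ Real.smoothTransition ((‖y‖ ^ 2 - a ^ 2) / (b ^ 2 - a ^ 2)), ?_, ?_, ?_⟩
  · exact Real.smoothTransition.contDiff.comp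
      (((contDiff_norm_sq ℝ).sub contDiff_const).div_const _)
  · intro y hy
    apply Real.smoothTransition.zero_of_nonpos
    apply div_nonpos_of_nonpos_of_nonneg
    · nlinarith [norm_nonneg y]
    · nlinarith
  · intro y hy
    apply Real.smoothTransition.one_of_one_le
    rw [le_div_iff₀ (by nlinarith)]
    nlinarith

/-- Locality of the spherical Laplacian: functions agreeing near `y` have the same `T` at `y`.
[folklore] -/
theorem sphLaplacian_congr_of_eventuallyEq {f g : E3 → ℝ} {y : E3} (h : f =ᶠ[𝓝 y] g) :
    sphLaplacian (EuclideanSpace.basisFun (Fin 3) ℝ) f y =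
      sphLaplacian (EuclideanSpace.basisFun (Fin 3) ℝ) g y := by
  unfold sphLaplacian
  congr 1
  refine Finset.sum_congr rfl fun i _ ↦ Finset.sum_congr rfl fun j _ ↦ ?_
  have h1 : angDeriv (EuclideanSpace.basisFun (Fin 3) ℝ) i j f =ᶠ[𝓝 y]
      angDeriv (EuclideanSpace.basisFun (Fin 3) ℝ) i j g := by
    filter_upwards [h.fderiv (𝕜 := ℝ)] with z hz
    rw [angDeriv_apply, angDeriv_apply, hz]
  rw [angDeriv_apply, angDeriv_apply, h1.fderiv_eq]

/-- **Integration by parts on spheres against an eigenfunction**, for functions of class `C²`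
on a shell `{‖y‖ > ρ₀}` (`0 ≤ ρ₀ < r`): `∫ G(θ) (T q)(rθ) dσ = −λ ∫ G(θ) q(rθ) dσ`. [folklore] -/
theorem integral_eigenfun_mul_sphLaplacian {q : E3 → ℝ} {ρ₀ r : ℝ} (hρ₀ : 0 ≤ ρ₀) (hr : ρ₀ < r)
    (hq : ContDiffOn ℝ 2 q {y : E3 | ρ₀ < ‖y‖}) {K : ℕ} (a : Fin (MvPoly.HomL2.dim 3 K)) :
    ∫ θ : sphere (0 : E3) 1, MvPoly.HomL2.eigenfun (K := K) two_le_three a θ *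
        sphLaplacian (EuclideanSpace.basisFun (Fin 3) ℝ) q (r • (θ : E3))
        ∂(volume : Measure E3).toSphere =
      -(MvPoly.HomL2.eigenlam (K := K) two_le_three a) *
        ∫ θ : sphere (0 : E3) 1, MvPoly.HomL2.eigenfun (K := K) two_le_three a θ * q (r • (θ : E3))
          ∂(volume : Measure E3).toSphere := by
  set G := MvPoly.HomL2.eigenfun (K := K) two_le_three a with hG
  set lam := MvPoly.HomL2.eigenlam (K := K) two_le_three a with hlam
  set b := EuclideanSpace.basisFun (Fin 3) ℝ with hb
  have hr0 : 0 < r := lt_of_le_of_lt hρ₀ hr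
  -- the cutoff
  set a₁ := ρ₀ + (r - ρ₀) / 3 with ha₁
  set b₁ := ρ₀ + 2 * (r - ρ₀) / 3 with hb₁
  have ha₁0 : 0 < a₁ := by rw [ha₁]; linarith
  have hab : a₁ < b₁ := by rw [ha₁, hb₁]; linarith
  have hb₁r : b₁ < r := by rw [hb₁]; linarith
  have hρa : ρ₀ < a₁ := by rw [ha₁]; linarith
  obtain ⟨χ, hχ, hχ0, hχ1⟩ := exists_radial_cutoff ha₁0 hab
  set qt : E3 → ℝ := fun y ↦ χ y * q y with hqt
  have hopen : IsOpen {y : E3 | ρ₀ < ‖y‖} := isOpen_lt continuous_const continuous_norm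
  -- `qt` is `C²` everywhere
  have hqt2 : ContDiff ℝ 2 qt := by
    rw [contDiff_iff_contDiffAt]
    intro y
    by_cases hy : ρ₀ < ‖y‖
    · exact hχ.contDiffAt.mul
        (hq.contDiffAt (hopen.mem_nhds hy))
    · have hy' : ‖y‖ < a₁ := lt_of_le_of_lt (not_lt.1 hy) hρa
      have hzero : qt =ᶠ[𝓝 y] fun _ ↦ 0 := by
        filter_upwards [(isOpen_lt continuous_norm continuous_const).mem_nhds hy'] with z hz
        simp only [hqt, hχ0 z (le_of_lt hz), zero_mul]
      exact (contDiffAt_const (c := (0 : ℝ))).congr_of_eventuallyEq hzero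
  -- `qt = q` near the sphere of radius `r`
  have hnear : ∀ y : E3, b₁ < ‖y‖ → qt =ᶠ[𝓝 y] q := by
    intro y hy
    filter_upwards [(isOpen_lt continuous_const continuous_norm).mem_nhds hy] with z hz
    simp only [hqt, hχ1 z (le_of_lt hz), one_mul]
  have hsph : ∀ θ : sphere (0 : E3) 1, b₁ < ‖r • (θ : E3)‖ := fun θ ↦ by
    rw [norm_smul, Real.norm_eq_abs, abs_of_pos hr0, norm_eq_of_mem_sphere θ, mul_one]
    exact hb₁r
  -- integration by parts on `S_r`
  have hG1 : ContDiffOn ℝ 1 G {0}ᶜ := (MvPoly.HomL2.contDiff_eigenfun two_le_three a).contDiffOn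
  have hG2 : ContDiffOn ℝ 2 G {0}ᶜ := (MvPoly.HomL2.contDiff_eigenfun two_le_three a).contDiffOn
  have hqt1 : ContDiffOn ℝ 1 qt {0}ᶜ := (hqt2.of_le (by norm_num)).contDiffOn
  have h1 := sphDirichlet_eq_neg_sphereIntegral b hG1 hqt2.contDiffOn hr0
  have h2 := sphDirichlet_eq_neg_sphereIntegral b hqt1 hG2 hr0
  rw [sphDirichlet_comm] at h2
  have h3 : sphereIntegral (volume : Measure E3) (fun x ↦ G x * sphLaplacian b qt x) r =
      sphereIntegral (volume : Measure E3) (fun x ↦ qt x * sphLaplacian b G x) r := by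
    linarith
  rw [sphereIntegral_def, sphereIntegral_def] at h3
  -- rewrite both sides on the sphere
  have hL : ∀ θ : sphere (0 : E3) 1, G (r • (θ : E3)) * sphLaplacian b qt (r • (θ : E3)) =
      r ^ K * (G θ * sphLaplacian b q (r • (θ : E3))) := fun θ ↦ by
    rw [hG, eigenfun_smul, ← hG, hb, sphLaplacian_congr_of_eventuallyEq (hnear _ (hsph θ))]
    ring
  have hR : ∀ θ : sphere (0 : E3) 1, qt (r • (θ : E3)) * sphLaplacian b G (r • (θ : E3)) =
      r ^ K * (-lam * (G θ * q (r • (θ : E3)))) := fun θ ↦ by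
    rw [(hnear _ (hsph θ)).eq_of_nhds, hG, hb, MvPoly.HomL2.sphLaplacian_eigenfun,
      eigenfun_smul, ← hG, ← hlam]
    ring
  simp_rw [hL, hR] at h3
  rw [integral_const_mul, integral_const_mul, integral_const_mul] at h3
  have hrK : r ^ K ≠ 0 := pow_ne_zero _ hr0.ne'
  exact mul_left_cancel₀ hrK h3

end EternalPapapetrou.ModeRigidity

end Summit.FinalStateConjecture.FinalStateConjecture.Theorems
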